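import Literature.AnabelianGeometry.SemiGraphs.CechNerveSquares
import Literature.AnabelianGeometry.SemiGraphs.OverPrimeProd
import Mathlib.CategoryTheory.Limits.Shapes.Equalizers
import HarnessLib

/-!
# Semi-graphs of anabelioids, Appendix, proof of Theorem A.4 (Čech route): the two-term Čech nerve
# `X ↦ ((X ⨯ A) ⨯ A ⇉ X ⨯ A)` as a functor into diagrams in `C[A]`

Mochizuki, *Semi-graphs of anabelioids*, Publ. RIMS **42** (2006) 221–322, Appendix, Theorem A.4
(manuscript pp. 82–86) [cite: MochizukiSemiAnbd2006, Thm A.4 pp.82-86].  Row A4-∃ of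
`plan/L3/SUBDAG-SemiAnbd-Cor311.md` (holder abc-iut-w5-d129; cut 2026-08-26T03:36/03:40Z, shape E1
(iii)): the functor of record

  `CechSq.nerve A : C ⥤ (WalkingParallelPair ⥤ Over' A)`,
  `X ↦ (homMk k₁, homMk k₂ : ((X ⨯ A) ⨯ A, pr_A) ⇉ (X ⨯ A, pr_A))`

over abc-iut-w4-d048's `CechSq.k₁/k₂/mapP/mapK` (`CechNerveSquares.lean`) and abc-iut-w5-d220's
`OverPrime.prodA` (`OverPrimeProd.lean`), for ANY category `C` with binary products and any `A : C`.
It is the `nerve` field of the Čech presentation (`ThmA4CechPresentation.lean`, abc-iut-w4-d081) that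
file E2 (`QuasiTemperoidsThmA4CechExtension`) instantiates and whose extension
`ψ^*(X) := colim (nerve X ⋙ F ⋙ ι₁)` file E3 (`QuasiTemperoidsThmA4CechLimits`) proves left exact.
Also recorded: the evaluations `nerve ⋙ ev₁ = prodA`, `nerve ⋙ ev₀ = (prodA-twice)` on the nose
(`nerveCompEvalOneIso`, `nerveCompEvalZeroIso`, identity components) and the Čech cofork
`nerveCofork X : Cofork` with vertex `X` (`pr_X : X ⨯ A → X`), natural in `X`.

Pure category theory; nothing refers to the IUT corpus; no side is taken on any disputed claim.
-/

open CategoryTheory CategoryTheory.Limits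

noncomputable section

namespace Literature.AnabelianGeometry.SemiGraphs

namespace CechSq

universe v₁ u₁

variable {C : Type u₁} [Category.{v₁} C] [HasBinaryProducts C] (A : C)

/-- `X ⨯ A` as an object of `C[A] = Over' A` (structure arrow `pr_A`) — `(OverPrime.prodA A).obj X`.
[cite: MochizukiSemiAnbd2006, Thm A.4 pp.82-86] -/
abbrev POver (X : C) : Over' A := (OverPrime.prodA A).obj X

/-- `(X ⨯ A) ⨯ A` as an object of `C[A]` (structure arrow the last projection).
[cite: MochizukiSemiAnbd2006, Thm A.4 pp.82-86] -/
abbrev KOver (X : C) : Over' A := (OverPrime.prodA A).obj (X ⨯ A)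

/-- `k₁` as an arrow of `C[A]`. [cite: MochizukiSemiAnbd2006, Thm A.4 pp.82-86] -/
abbrev k₁Over (X : C) : KOver A X ⟶ POver A X := ObjectProperty.homMk (k₁ A X)

/-- `k₂` as an arrow of `C[A]`. [cite: MochizukiSemiAnbd2006, Thm A.4 pp.82-86] -/
abbrev k₂Over (X : C) : KOver A X ⟶ POver A X := ObjectProperty.homMk (k₂ A X)

/-- **The two-term Čech nerve as a functor** `C ⥤ (WalkingParallelPair ⥤ C[A])`,
`X ↦ ((X ⨯ A) ⨯ A ⇉ X ⨯ A)`, on arrows `((u ⨯ A) ⨯ A, u ⨯ A)`.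
[cite: MochizukiSemiAnbd2006, Thm A.4 pp.82-86] -/
def nerve : C ⥤ (WalkingParallelPair ⥤ Over' A) where
  obj X := parallelPair (k₁Over A X) (k₂Over A X)
  map u := parallelPairHom _ _ _ _ (ObjectProperty.homMk (mapK A u)) (ObjectProperty.homMk (mapP A u))
    (by ext : 1; exact (mapK_k₁ A u).symm) (by ext : 1; exact (mapK_k₂ A u).symm)
  map_id X := by
    ext j : 2
    cases j <;> (apply ObjectProperty.hom_ext; simp [mapK, mapP])
  map_comp f g := by
    ext j : 2
    cases j <;> (apply ObjectProperty.hom_ext; simp [mapK, mapP])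

/-- The nerve at `one` is `X ⨯ A`. [cite: MochizukiSemiAnbd2006, Thm A.4 pp.82-86] -/
@[simp] theorem nerve_obj_obj_one (X : C) : ((nerve A).obj X).obj WalkingParallelPair.one = POver A X :=
  rfl

/-- The nerve at `zero` is `(X ⨯ A) ⨯ A`. [cite: MochizukiSemiAnbd2006, Thm A.4 pp.82-86] -/
@[simp] theorem nerve_obj_obj_zero (X : C) :
    ((nerve A).obj X).obj WalkingParallelPair.zero = KOver A X :=
  rfl

/-- The nerve's `left` arrow is `k₁`. [cite: MochizukiSemiAnbd2006, Thm A.4 pp.82-86] -/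
@[simp] theorem nerve_obj_map_left (X : C) :
    ((nerve A).obj X).map WalkingParallelPairHom.left = k₁Over A X :=
  rfl

/-- The nerve's `right` arrow is `k₂`. [cite: MochizukiSemiAnbd2006, Thm A.4 pp.82-86] -/
@[simp] theorem nerve_obj_map_right (X : C) :
    ((nerve A).obj X).map WalkingParallelPairHom.right = k₂Over A X :=
  rfl

/-- The nerve on arrows, at `one`: `u ⨯ A`. [cite: MochizukiSemiAnbd2006, Thm A.4 pp.82-86] -/
@[simp] theorem nerve_map_app_one {X Y : C} (u : X ⟶ Y) :
    ((nerve A).map u).app WalkingParallelPair.one = ObjectProperty.homMk (mapP A u) :=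
  rfl

/-- The nerve on arrows, at `zero`: `(u ⨯ A) ⨯ A`. [cite: MochizukiSemiAnbd2006, Thm A.4 pp.82-86] -/
@[simp] theorem nerve_map_app_zero {X Y : C} (u : X ⟶ Y) :
    ((nerve A).map u).app WalkingParallelPair.zero = ObjectProperty.homMk (mapK A u) :=
  rfl

/-- **`nerve ⋙ ev₁ ≅ prodA`** (identity components). [cite: MochizukiSemiAnbd2006, Thm A.4 pp.82-86] -/
def nerveCompEvalOneIso :
    nerve A ⋙ (evaluation WalkingParallelPair (Over' A)).obj WalkingParallelPair.one ≅
      OverPrime.prodA A :=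
  NatIso.ofComponents (fun _ => Iso.refl _) (fun u => by
    apply ObjectProperty.hom_ext
    exact (Category.comp_id _).trans (Category.id_comp _).symm)

/-- **`nerve ⋙ ev₀ ≅ (− ⨯ A) ⋙ prodA`** (identity components). [cite: MochizukiSemiAnbd2006, Thm A.4 pp.82-86] -/
def nerveCompEvalZeroIso :
    nerve A ⋙ (evaluation WalkingParallelPair (Over' A)).obj WalkingParallelPair.zero ≅
      prod.functor.flip.obj A ⋙ OverPrime.prodA A :=
  NatIso.ofComponents (fun _ => Iso.refl _) (fun u => by
    apply ObjectProperty.hom_ext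
    exact (Category.comp_id _).trans (Category.id_comp _).symm)

/-- **The Čech cofork** `(X ⨯ A) ⨯ A ⇉ X ⨯ A → X` in `C` (vertex `X`, leg `pr_X`), as a cofork on the
underlying pair `k₁, k₂`. [cite: MochizukiSemiAnbd2006, Thm A.4 pp.82-86] -/
abbrev nerveCofork (X : C) : Cofork (k₁ A X) (k₂ A X) := Cofork.ofπ prod.fst (k₁_fst A X)

/-- The Čech cofork leg is natural: `(u ⨯ A) ≫ pr_Y = pr_X ≫ u`. [cite: MochizukiSemiAnbd2006, Thm A.4 pp.82-86] -/
@[reassoc] theorem mapP_fst {X Y : C} (u : X ⟶ Y) : mapP A u ≫ prod.fst = prod.fst ≫ u := by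
  simp [mapP]

end CechSq

end Literature.AnabelianGeometry.SemiGraphs

end
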